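import Summits.Ventures.Crystal3D.Theorems.StickyWulffConstantTextureLiminfTexShadowTerraceCensusTwo
import HarnessLib

/-!
# Off the Σ9 sliver every `13/25`-capped table is census-dominated: `censusRegimeAt_of_not_sliver`
# (lane T, crux `TextureLiminfV5`, stmt-Ventures-23912, line `TexShadow` v8.16 bump β; cf-p1 RULING (ccxxxiii) item (1); 19480-p1 g18)

HONEST FRAMING. Venture `Summits/Ventures/Crystal3D` (cell `crystal3d-full`), helper `--supports` the law-v5 crux `TextureLiminfV5`
(stmt-Ventures-23912), lane T.  An elementary REDUCTION about the census regime `CensusRegimeAt` (…TerraceCensusDefs p726089) from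
…TerraceCensusThree (p726475: words of length `≥ 3` have census `≥ 4√2/9 > 13/25`) and …TerraceCensusTwo (p727235: a length-2 word whose
two twin normals are both `≥ arcsin (1/5) ≈ 11.54°` from the wall normal has census `≥ 13/25`).  No configuration, no certificate; F-C1 not moved.

THE POINT.  v8.16 re-typed the three EDGE-ON class stubs as REMAINDERS on `X ∧ ¬ CensusRegimeAt (13/25)`; this file names the complement:
* `SigmaNineSliverAt σ₁ σ₂ L₁ L₂` — **the Σ9 SLIVER**: some bilayer framing of the two presented plates has a facing pair `(i, j)` related
  by a reduced admissible word of length EXACTLY 2 one of whose two spatial twin normals `v` has `⟪v, e₃⟫² > 24/25` (within `≈ 11.54°` of `±e₃`);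
* **`censusRegimeAt_of_not_sliver`** — off the sliver, EVERY `13/25`-capped admissible table is census-dominated, i.e. `CensusRegimeAt (13/25)`;
* `not_censusRegimeAt_imp_sliver` — contrapositive, the form the remainder stubs consume: `¬ CensusRegimeAt (13/25) … → SigmaNineSliverAt …`.
So the remainders `stub_edgeOn{RowRead,Sep,Read}Rem` live on `X ∧ SigmaNineSliverAt` — finite lists + lane G's Σ9 classes (cf-p1 (ccxxxiii)).
WHAT THIS IS NOT: any statement about the remainders themselves or about lane G's Σ9 cells; F-C1 not moved.
-/

noncomputable section

open scoped BigOperators InnerProductSpace ENNReal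
open MeasureTheory Filter

namespace Summit.Ventures.Crystal3D.Cruxes.TextureLiminf.TexShadow

open Summit.Ventures.Crystal3D Summit.Ventures.Crystal3D.Theorems
open Literature.MathematicalPhysics.StatisticalMechanics (IsHaggSeq fccStacking barlowStacking basalMirror)

/-- **THE Σ9 SLIVER** of a presented pair: for some bilayer framing, some facing pair of bilayer frames `(A₁ i, A₂ j)` is related by a reduced
admissible word of length exactly `2` — `(A₂ j)·Λ₀ = (wordFrame (A₁ i) [ν₂, ν₁])·Λ₀`, letters `ν₁` (crossed first) and `ν₂` unit `{111}` menu normals at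
`⟪ν₁, ν₂⟫ = ±1/3` — one of whose two SPATIAL twin normals `A₁ i ν₁`, `A₁ i (R_{ν₁} ν₂)` lies within `arcsin (1/5) ≈ 11.54°` of `±e₃`
(`⟪·, e₃⟫² > 24/25`).  Exactly the pairs on which `censusSum_two_ge_of_far` does not certify `13/25`. -/
def SigmaNineSliverAt (σ₁ σ₂ : ℤ → ℤ) (L₁ L₂ : E3 ≃ₗᵢ[ℝ] E3) : Prop :=
  ∃ (s₁ s₂ : E3) (A₁ A₂ : ℤ → (E3 ≃ₗᵢ[ℝ] E3)) (u₁ u₂ : ℤ → E3),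
    BilayerFramesAt L₁ s₁ σ₁ A₁ u₁ ∧ BilayerFramesAt L₂ s₂ σ₂ A₂ u₂ ∧
    ∃ (i j : ℤ) (ν₁ ν₂ : E3),
      (‖ν₁‖ = 1 ∧ ∀ w ∈ fccSlots, ⟪w, ν₁⟫_ℝ = 0 ∨ ⟪w, ν₁⟫_ℝ = Real.sqrt (2 / 3) ∨ ⟪w, ν₁⟫_ℝ = -Real.sqrt (2 / 3)) ∧
      (‖ν₂‖ = 1 ∧ ∀ w ∈ fccSlots, ⟪w, ν₂⟫_ℝ = 0 ∨ ⟪w, ν₂⟫_ℝ = Real.sqrt (2 / 3) ∨ ⟪w, ν₂⟫_ℝ = -Real.sqrt (2 / 3)) ∧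
      (⟪ν₁, ν₂⟫_ℝ = 1 / 3 ∨ ⟪ν₁, ν₂⟫_ℝ = -1 / 3) ∧
      A₂ j '' fccStacking 1 (Real.sqrt (2 / 3)) = (wordFrame (A₁ i) [ν₂, ν₁]) '' fccStacking 1 (Real.sqrt (2 / 3)) ∧
      (24 / 25 < ⟪A₁ i ν₁, e₃⟫_ℝ ^ 2 ∨ 24 / 25 < ⟪A₁ i ((ℝ ∙ ν₁)ᗮ.reflection ν₂), e₃⟫_ℝ ^ 2)

/-- **OFF THE Σ9 SLIVER THE CENSUS REGIME HOLDS AT `13/25`**: every admissible table capped at `13/25`, for any bilayer framing of the two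
plates, is census-dominated — words of length `≥ 3` by `censusSum_ge_of_three_le_length` (`4√2/9 > 13/25`), words of length `2` by
`censusSum_two_ge_of_far` (both twin normals off the caps, which is what `¬ SigmaNineSliverAt` says). -/
theorem censusRegimeAt_of_not_sliver {σ₁ σ₂ : ℤ → ℤ} {L₁ L₂ : E3 ≃ₗᵢ[ℝ] E3} (hns : ¬ SigmaNineSliverAt σ₁ σ₂ L₁ L₂) :
    CensusRegimeAt (13 / 25) σ₁ σ₂ L₁ L₂ := by
  intro s₁ s₂ A₁ A₂ u₁ u₂ hA₁ hA₂ c m hadm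
  refine censusDominatedAt_of_cap_of_two hadm.2.1 (fun i j κ hκl hκc hlen himg => ?_)
  match κ, hκl, hκc, hlen, himg with
  | [a, b], hκl, hκc, _, himg =>
    have ha := hκl a (by simp)
    have hb := hκl b (by simp)
    have hab : ⟪a, b⟫_ℝ = 1 / 3 ∨ ⟪a, b⟫_ℝ = -1 / 3 := by
      rw [List.isChain_cons_cons] at hκc; exact hκc.1
    have hba : ⟪b, a⟫_ℝ = 1 / 3 ∨ ⟪b, a⟫_ℝ = -1 / 3 := by rw [real_inner_comm]; exact hab
    -- both twin normals are off the caps, else the sliver is witnessed by `(b, a)`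
    have hfar : ⟪A₁ i b, e₃⟫_ℝ ^ 2 ≤ 24 / 25 ∧ ⟪A₁ i ((ℝ ∙ b)ᗮ.reflection a), e₃⟫_ℝ ^ 2 ≤ 24 / 25 := by
      by_contra hcon
      refine hns ⟨s₁, s₂, A₁, A₂, u₁, u₂, hA₁, hA₂, i, j, b, a, hb, ha, hba, himg, ?_⟩
      rcases not_and_or.1 hcon with h | h
      · exact Or.inl (lt_of_not_ge h)
      · exact Or.inr (lt_of_not_ge h)
    have key := censusSum_two_ge_of_far (A₁ i) hb ha.1 hba hfar.1 hfar.2 []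
    simp only [List.reverse_cons, List.reverse_nil, List.nil_append, List.cons_append]
    exact (hadm.2.1 i j).trans key

/-- Contrapositive, the form consumed by the remainder stubs of `TexShadow` v8.16: a pair OUTSIDE the census regime at `13/25` lies on the Σ9 sliver. -/
theorem sliver_of_not_censusRegimeAt {σ₁ σ₂ : ℤ → ℤ} {L₁ L₂ : E3 ≃ₗᵢ[ℝ] E3} (h : ¬ CensusRegimeAt (13 / 25) σ₁ σ₂ L₁ L₂) :
    SigmaNineSliverAt σ₁ σ₂ L₁ L₂ := by
  by_contra hns
  exact h (censusRegimeAt_of_not_sliver hns)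

/-- **The remainders may assume the sliver**: a core bound on `X ∧ SigmaNineSliverAt` gives the registered remainder on
`X ∧ ¬ CensusRegimeAt (13/25)` (monotonicity of the residual core in the class). -/
theorem remainder_of_sliver (X : (ℤ → ℤ) → (ℤ → ℤ) → (E3 ≃ₗᵢ[ℝ] E3) → (E3 ≃ₗᵢ[ℝ] E3) → Prop) {c₀ C R₀ : ℝ}
    (h : BilayerWallResidualFaultedCoreOnAt (fun σ₁ σ₂ L₁ L₂ => X σ₁ σ₂ L₁ L₂ ∧ SigmaNineSliverAt σ₁ σ₂ L₁ L₂) c₀ C R₀) :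
    BilayerWallResidualFaultedCoreOnAt (fun σ₁ σ₂ L₁ L₂ => X σ₁ σ₂ L₁ L₂ ∧ ¬ CensusRegimeAt (13 / 25) σ₁ σ₂ L₁ L₂) c₀ C R₀ :=
  residualFaultedCoreOnAt_anti (fun _ _ _ _ hx => ⟨hx.1, sliver_of_not_censusRegimeAt hx.2⟩) h

/-- **Splitting a class stub along the sliver** (`R₀ = 10`): the census on its regime plus a remainder on `X ∧ SigmaNineSliverAt` give the core
on all of `X` at cap `13/25`. -/
theorem coreOn_of_terraceCensus_of_sliverRemainder (X : (ℤ → ℤ) → (ℤ → ℤ) → (E3 ≃ₗᵢ[ℝ] E3) → (E3 ≃ₗᵢ[ℝ] E3) → Prop) {C : ℝ}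
    (h : TerraceCensusAt C 10)
    (hrem : ∃ C' : ℝ, BilayerWallResidualFaultedCoreOnAt
      (fun σ₁ σ₂ L₁ L₂ => X σ₁ σ₂ L₁ L₂ ∧ SigmaNineSliverAt σ₁ σ₂ L₁ L₂) (13 / 25) C' 10) :
    ∃ C'' : ℝ, BilayerWallResidualFaultedCoreOnAt X (13 / 25) C'' 10 := by
  obtain ⟨C', h'⟩ := hrem
  exact coreOn_of_terraceCensus_of_remainder X h ⟨C', remainder_of_sliver X h'⟩

end Summit.Ventures.Crystal3D.Cruxes.TextureLiminf.TexShadow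

end
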